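import Mathlib.Analysis.Calculus.InverseFunctionTheorem.ContDiff
import Mathlib.Analysis.Calculus.ContDiff.Operations
import Mathlib.Geometry.Manifold.PartitionOfUnity
import Mathlib.Topology.Algebra.Module.FiniteDimension
import HarnessLib

/-!
# Embedding germs of compact sets: smooth maps which are embeddings near a compact set

Topic `Literature/Topology/FourManifolds` (programme of the fact
`Literature.Topology.FourManifolds.cerf_pi0DiffDisc_relBoundary_three`, brick C3: the pieces of Cerf's Alexander decompositions and
their parametrisations, Cerf 1968 Ch. III §2 and Ch. IV §3–5, are handled in the tree as
compact subsets of `ℝ³` moved by everywhere-defined smooth maps which are diffeomorphisms near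
them).  For a finite-dimensional real normed space `E` and a compact `K ⊆ E`, a smooth map
`f : E → E` is an **embedding germ along `K`** (`IsEmbGerm K f`) when its derivative is
invertible at every point of `K` and it is injective on `K`.  This file proves the germ
calculus used to compose, invert and glue such parametrisations:

* `IsEmbGerm.exists_nhds` — the conditions propagate to a neighbourhood: `f` is injective with
  invertible derivative on an open `U ⊇ K` (local injectivity from the inverse function theorem,
  globalised on `K × K` by compactness, `IsCompact.nhdsSet_prod_eq`);
* `IsEmbGerm.image_mem_nhdsSet` — `f` maps neighbourhoods of `K` to neighbourhoods of `f '' K`;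
* `IsEmbGerm.comp`, `IsEmbGerm.mono`, `IsEmbGerm.id`;
* `IsEmbGerm.exists_inverse` — **an inverse germ**: a smooth `g : E → E`, an embedding germ along
  `f '' K`, with `g ∘ f = id` near `K` and `f ∘ g = id` near `f '' K` (the local inverses of the
  inverse function theorem patched by injectivity and cut off by a smooth Urysohn function).

## References
* M. W. Hirsch, *Differential Topology*, GTM 33 (1976), Ch. 1 §3 (an injective immersion of a
  compact set embeds a neighbourhood), Ch. 2 §2 (germs). [HirschDT1976]
* J. Cerf, *Sur les difféomorphismes de la sphère de dimension trois (Γ₄ = 0)*, LNM 53 (1968),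
  Ch. IV §3 (the spaces `ℰ_k` of embeddings of the models). [CerfDiffeoSphere1968]
-/

noncomputable section

open Set Function Filter Topology
open scoped ContDiff Manifold

namespace Literature.Topology.FourManifolds

variable {E : Type*} [NormedAddCommGroup E] [NormedSpace ℝ E]

/-- **Embedding germ along a set**: a smooth map of `E` whose derivative is invertible at every
point of `K` and which is injective on `K`.  For compact `K` these conditions hold on a whole
neighbourhood (`IsEmbGerm.exists_nhds`), so `f` is a diffeomorphism from a neighbourhood of `K`
onto a neighbourhood of `f '' K`. [cite: HirschDT1976, Ch. 1 §3 and Ch. 2 §2] -/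
structure IsEmbGerm (K : Set E) (f : E → E) : Prop where
  /-- The map is smooth everywhere. -/
  contDiff : ContDiff ℝ ∞ f
  /-- The derivative is invertible at every point of `K`. -/
  isInvertible : ∀ x ∈ K, (fderiv ℝ f x).IsInvertible
  /-- The map is injective on `K`. -/
  injOn : InjOn f K

namespace IsEmbGerm

variable {K K' : Set E} {f g : E → E}

/-- Restriction to a subset. [folklore] -/
theorem mono (h : IsEmbGerm K f) (hK : K' ⊆ K) : IsEmbGerm K' f :=
  ⟨h.contDiff, fun x hx => h.isInvertible x (hK hx), h.injOn.mono hK⟩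

/-- The identity is an embedding germ along every set. [folklore] -/
protected theorem id (K : Set E) : IsEmbGerm K (id : E → E) :=
  ⟨contDiff_id, fun x _ => by rw [fderiv_id]; exact ⟨ContinuousLinearEquiv.refl ℝ E, rfl⟩,
    injOn_id K⟩

/-- Strict differentiability with an equivalence as derivative, at a point of `K`. [folklore] -/
theorem exists_hasStrictFDerivAt [CompleteSpace E] (h : IsEmbGerm K f) {x : E} (hx : x ∈ K) :
    ∃ e : E ≃L[ℝ] E, HasStrictFDerivAt f (e : E →L[ℝ] E) x := by
  obtain ⟨e, he⟩ := h.isInvertible x hx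
  exact ⟨e, by rw [he]; exact h.contDiff.contDiffAt.hasStrictFDerivAt (by simp)⟩

/-- **Composition** of embedding germs. [folklore] -/
theorem comp (hg : IsEmbGerm (f '' K) g) (hf : IsEmbGerm K f) : IsEmbGerm K (g ∘ f) := by
  refine ⟨hg.contDiff.comp hf.contDiff, fun x hx => ?_,
    hg.injOn.comp hf.injOn (mapsTo_image f K)⟩
  obtain ⟨ef, hef⟩ := hf.isInvertible x hx
  obtain ⟨eg, heg⟩ := hg.isInvertible (f x) (mem_image_of_mem f hx)
  have hdf : DifferentiableAt ℝ f x := hf.contDiff.differentiable (by simp) x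
  have hdg : DifferentiableAt ℝ g (f x) := hg.contDiff.differentiable (by simp) (f x)
  rw [fderiv_comp x hdg hdf, ← hef, ← heg]
  exact ⟨ef.trans eg, by ext v; simp⟩

/-! ### The conditions propagate to a neighbourhood -/

/-- The set of points where the derivative of a `C¹` map is invertible is open. [folklore] -/
theorem isOpen_setOf_isInvertible_fderiv [CompleteSpace E] (hf : ContDiff ℝ ∞ f) :
    IsOpen {x : E | (fderiv ℝ f x).IsInvertible} := by
  have hc : Continuous fun x => fderiv ℝ f x := hf.continuous_fderiv (by simp)
  have h : {x : E | (fderiv ℝ f x).IsInvertible} =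
      (fun x => fderiv ℝ f x) ⁻¹' range ((↑) : (E ≃L[ℝ] E) → E →L[ℝ] E) := by
    ext x; rfl
  rw [h]
  exact ContinuousLinearEquiv.isOpen.preimage hc

/-- **Local injectivity**: near a point of `K` (in `E × E`), equal images force equal points.
[folklore] -/
theorem eventually_eq_of_apply_eq [CompleteSpace E] (h : IsEmbGerm K f) {x : E} (hx : x ∈ K) :
    ∀ᶠ p : E × E in 𝓝 (x, x), f p.1 = f p.2 → p.1 = p.2 := by
  obtain ⟨e, he⟩ := h.exists_hasStrictFDerivAt hx
  have hl := he.eventually_left_inverse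
  have h2 : ∀ᶠ p : E × E in 𝓝 (x, x), he.localInverse f _ x (f p.1) = p.1 ∧
      he.localInverse f _ x (f p.2) = p.2 := by
    rw [nhds_prod_eq]
    exact hl.prod_mk hl
  exact h2.mono fun p hp hfp => by rw [← hp.1, ← hp.2, hfp]

/-- **An injective local diffeomorphism along a compact set embeds a neighbourhood**: there is an
open `U ⊇ K` on which `f` is injective with invertible derivative.
[cite: HirschDT1976, Ch. 1 §3, Lemma 3.3 / Ex. 2] -/
theorem exists_nhds [FiniteDimensional ℝ E] (hK : IsCompact K) (h : IsEmbGerm K f) :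
    ∃ U : Set E, IsOpen U ∧ K ⊆ U ∧ InjOn f U ∧ ∀ x ∈ U, (fderiv ℝ f x).IsInvertible := by
  haveI : CompleteSpace E := FiniteDimensional.complete ℝ E
  -- the "good pairs" form a neighbourhood of `K × K`
  have hmem : {p : E × E | f p.1 = f p.2 → p.1 = p.2} ∈ 𝓝ˢ (K ×ˢ K) := by
    refine (mem_nhdsSet_iff_forall).2 fun p hp => ?_
    obtain ⟨x, y⟩ := p
    obtain ⟨hx, hy⟩ := mem_prod.1 hp
    by_cases hxy : x = y
    · subst hxy
      exact h.eventually_eq_of_apply_eq hx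
    · have hne : f x ≠ f y := fun hfe => hxy (h.injOn hx hy hfe)
      have hc : Continuous fun p : E × E => f p.1 - f p.2 :=
        (h.contDiff.continuous.comp continuous_fst).sub (h.contDiff.continuous.comp continuous_snd)
      have hev : ∀ᶠ p : E × E in 𝓝 (x, y), f p.1 - f p.2 ≠ 0 :=
        (hc.continuousAt).eventually_ne (sub_ne_zero.2 hne)
      exact hev.mono fun p hp hfe => absurd (sub_eq_zero.2 hfe) hp
  rw [hK.nhdsSet_prod_eq hK] at hmem
  obtain ⟨U₁, hU₁, U₂, hU₂, hsub⟩ := Filter.mem_prod_iff.1 hmem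
  have hO : {x : E | (fderiv ℝ f x).IsInvertible} ∈ 𝓝ˢ K :=
    (isOpen_setOf_isInvertible_fderiv h.contDiff).mem_nhdsSet.2 fun x hx => h.isInvertible x hx
  have hall : U₁ ∩ U₂ ∩ {x : E | (fderiv ℝ f x).IsInvertible} ∈ 𝓝ˢ K :=
    Filter.inter_mem (Filter.inter_mem hU₁ hU₂) hO
  obtain ⟨U, hUo, hKU, hUsub⟩ := mem_nhdsSet_iff_exists.1 hall
  refine ⟨U, hUo, hKU, fun x hx y hy hfe => ?_, fun x hx => (hUsub hx).2⟩
  have hp : ((x, y) : E × E) ∈ U₁ ×ˢ U₂ := ⟨(hUsub hx).1.1, (hUsub hy).1.2⟩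
  exact hsub hp hfe

/-- **An embedding germ maps neighbourhoods of `K` to neighbourhoods of `f '' K`** (open
mapping at each point of `K`). [folklore] -/
theorem image_mem_nhdsSet [CompleteSpace E] (h : IsEmbGerm K f) {V : Set E} (hV : V ∈ 𝓝ˢ K) :
    f '' V ∈ 𝓝ˢ (f '' K) := by
  refine (mem_nhdsSet_iff_forall).2 ?_
  rintro _ ⟨x, hx, rfl⟩
  obtain ⟨e, he⟩ := h.exists_hasStrictFDerivAt hx
  rw [← he.map_nhds_eq_of_equiv]
  exact image_mem_map (mem_nhdsSet_iff_forall.1 hV x hx)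

/-- The image of an open set on which the derivative is invertible is open. [folklore] -/
theorem isOpen_image [CompleteSpace E] (hf : ContDiff ℝ ∞ f) {V : Set E} (hV : IsOpen V)
    (hinv : ∀ x ∈ V, (fderiv ℝ f x).IsInvertible) : IsOpen (f '' V) := by
  rw [isOpen_iff_mem_nhds]
  rintro _ ⟨x, hx, rfl⟩
  obtain ⟨e, he⟩ := hinv x hx
  have hs : HasStrictFDerivAt f (e : E →L[ℝ] E) x := by
    rw [he]; exact hf.contDiffAt.hasStrictFDerivAt (by simp)
  rw [← hs.map_nhds_eq_of_equiv]
  exact image_mem_map (hV.mem_nhds hx)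

/-! ### The inverse germ -/

/-- **Smooth cut-off**: for a compact `C` inside an open `W` there is a smooth `χ : E → [0, 1]`
equal to `1` on a neighbourhood of `C` and to `0` on a neighbourhood of `Wᶜ`. [folklore] -/
theorem exists_cutoff [FiniteDimensional ℝ E] {C W : Set E} (hC : IsCompact C) (hW : IsOpen W)
    (hCW : C ⊆ W) :
    ∃ χ : E → ℝ, ContDiff ℝ ∞ χ ∧ (∀ᶠ x in 𝓝ˢ C, χ x = 1) ∧ (∀ᶠ x in 𝓝ˢ Wᶜ, χ x = 0) := by
  haveI : ProperSpace E := FiniteDimensional.proper ℝ E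
  -- two nested open sets between `C` and `W`
  obtain ⟨W₁, hW₁o, hCW₁, hW₁W, hW₁c⟩ := exists_open_between_and_isCompact_closure hC hW hCW
  obtain ⟨W₂, hW₂o, hCW₂, hW₂W, -⟩ :=
    exists_open_between_and_isCompact_closure hW₁c hW hW₁W
  have hd : Disjoint W₂ᶜ (closure W₁) := disjoint_compl_left_iff.2 hCW₂
  obtain ⟨χ, hχ0, hχ1, -⟩ := exists_contMDiffMap_zero_one_of_isClosed (I := 𝓘(ℝ, E)) (M := E)
    (n := (⊤ : ℕ∞)) hW₂o.isClosed_compl isClosed_closure hd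
  refine ⟨χ, χ.contMDiff.contDiff, ?_, ?_⟩
  · exact mem_nhdsSet_iff_exists.2 ⟨W₁, hW₁o, hCW₁, fun x hx => hχ1 (subset_closure hx)⟩
  · refine mem_nhdsSet_iff_exists.2 ⟨(closure W₂)ᶜ, isClosed_closure.isOpen_compl,
      compl_subset_compl.2 (hW₂W.trans (subset_refl W) |> fun h => ?_), fun x hx => hχ0 ?_⟩
    · exact h
    · exact fun hx2 => hx (subset_closure hx2)

/-- **The inverse germ.**  An embedding germ `f` along a compact `K` has a smooth inverse germ:
a smooth `g : E → E` which is an embedding germ along `f '' K`, with `g (f x) = x` for `x`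
near `K` and `f (g y) = y` for `y` near `f '' K`.
[cite: HirschDT1976, Ch. 1 §3 and Ch. 2 §2 (inverse function theorem for embeddings of compact sets)] -/
theorem exists_inverse [FiniteDimensional ℝ E] (hK : IsCompact K) (h : IsEmbGerm K f) :
    ∃ g : E → E, ContDiff ℝ ∞ g ∧ (∀ᶠ x in 𝓝ˢ K, g (f x) = x) ∧
      (∀ᶠ y in 𝓝ˢ (f '' K), f (g y) = y) ∧ IsEmbGerm (f '' K) g := by
  haveI : CompleteSpace E := FiniteDimensional.complete ℝ E
  haveI : ProperSpace E := FiniteDimensional.proper ℝ E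
  obtain ⟨U, hUo, hKU, hinj, hinv⟩ := h.exists_nhds hK
  -- an open `V` with compact closure inside `U`
  obtain ⟨V, hVo, hKV, hVU, hVc⟩ := exists_open_between_and_isCompact_closure hK hUo hKU
  have hVU' : V ⊆ U := subset_closure.trans hVU
  -- the set-theoretic inverse on `W = f '' V`
  obtain ⟨W, hW⟩ : ∃ W : Set E, W = f '' V := ⟨_, rfl⟩
  have hWo : IsOpen W := by rw [hW]; exact isOpen_image h.contDiff hVo fun x hx => hinv x (hVU' hx)
  have hinjV : InjOn f V := hinj.mono hVU'
  obtain ⟨g₀, hg₀⟩ : ∃ g₀ : E → E, g₀ = invFunOn f V := ⟨_, rfl⟩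
  have hleft : ∀ x ∈ V, g₀ (f x) = x := fun x hx => by
    rw [hg₀]; exact hinjV.leftInvOn_invFunOn hx
  have hright : ∀ y ∈ W, f (g₀ y) = y := fun y hy => by
    rw [hW] at hy; rw [hg₀]; exact invFunOn_eq hy
  have hg₀V : ∀ y ∈ W, g₀ y ∈ V := fun y hy => by
    rw [hW] at hy; rw [hg₀]; exact invFunOn_mem hy
  -- `g₀` is smooth on `W`, with the inverse derivative
  have hsmooth : ∀ x ∈ V, ContDiffAt ℝ ∞ g₀ (f x) ∧
      ∃ e : E ≃L[ℝ] E, fderiv ℝ f x = (e : E →L[ℝ] E) ∧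
        HasStrictFDerivAt g₀ ((e.symm : E ≃L[ℝ] E) : E →L[ℝ] E) (f x) := by
    intro x hx
    obtain ⟨e, he⟩ := hinv x (hVU' hx)
    have hs : HasStrictFDerivAt f (e : E →L[ℝ] E) x := by
      rw [he]; exact h.contDiff.contDiffAt.hasStrictFDerivAt (by simp)
    have hfd : HasFDerivAt f (e : E →L[ℝ] E) x := hs.hasFDerivAt
    -- `g₀` agrees with the local inverse near `f x`
    have hloc : g₀ =ᶠ[𝓝 (f x)] hs.localInverse f _ x :=
      hs.localInverse_unique (by
        filter_upwards [hVo.mem_nhds hx] with y hy using hleft y hy)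
    have hcd : ContDiffAt ℝ ∞ (hs.localInverse f _ x) (f x) := by
      have h1 := h.contDiff.contDiffAt.to_localInverse (n := ∞) hfd (by simp)
      exact h1
    refine ⟨hcd.congr_of_eventuallyEq hloc, e, he.symm, ?_⟩
    exact hs.to_localInverse.congr_of_eventuallyEq hloc.symm
  -- cut-off equal to `1` near `f '' K` and `0` near `Wᶜ`
  have hfKW : f '' K ⊆ W := by rw [hW]; exact image_mono hKV
  obtain ⟨χ, hχs, hχ1, hχ0⟩ := exists_cutoff (hK.image h.contDiff.continuous) hWo hfKW
  obtain ⟨O, hOo, hKO, hO1⟩ := mem_nhdsSet_iff_exists.1 hχ1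
  obtain ⟨g, hg⟩ : ∃ g : E → E, g = fun y => χ y • g₀ y := ⟨_, rfl⟩
  -- smoothness: smooth on `W`, and `= 0` near `Wᶜ`
  have hgs : ContDiff ℝ ∞ g := by
    rw [hg, contDiff_iff_contDiffAt]
    intro y
    by_cases hy : y ∈ W
    · obtain ⟨x, hx, rfl⟩ : y ∈ f '' V := by rwa [hW] at hy
      exact hχs.contDiffAt.smul (hsmooth x hx).1
    · have h0 : (fun y => χ y • g₀ y) =ᶠ[𝓝 y] fun _ => (0 : E) := by
        have hy' : y ∈ Wᶜ := hy
        filter_upwards [hχ0.filter_mono (nhds_le_nhdsSet hy')] with z hz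
        rw [hz, zero_smul]
      exact (contDiffAt_const (c := (0 : E))).congr_of_eventuallyEq h0
  -- `g = g₀` near `f '' K`
  have hgg₀ : ∀ y ∈ O, g y = g₀ y := fun y hy => by
    rw [hg]
    show χ y • g₀ y = g₀ y
    rw [hO1 hy, one_smul]
  refine ⟨g, hgs, ?_, ?_, ⟨hgs, ?_, ?_⟩⟩
  · -- left inverse near `K`
    refine mem_nhdsSet_iff_exists.2 ⟨V ∩ f ⁻¹' O, hVo.inter (hOo.preimage h.contDiff.continuous),
      fun x hx => ⟨hKV hx, hKO (mem_image_of_mem f hx)⟩, fun x hx => ?_⟩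
    show g (f x) = x
    rw [hgg₀ _ hx.2, hleft x hx.1]
  · -- right inverse near `f '' K`
    refine mem_nhdsSet_iff_exists.2 ⟨O ∩ W, hOo.inter hWo, fun y hy => ⟨hKO hy, hfKW hy⟩,
      fun y hy => ?_⟩
    show f (g y) = y
    rw [hgg₀ _ hy.1, hright y hy.2]
  · -- invertible derivative on `f '' K`
    rintro _ ⟨x, hx, rfl⟩
    obtain ⟨-, e, -, hge⟩ := hsmooth x (hKV hx)
    have hev : g =ᶠ[𝓝 (f x)] g₀ := by
      filter_upwards [hOo.mem_nhds (hKO (mem_image_of_mem f hx))] with y hy using hgg₀ y hy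
    have hgd : HasStrictFDerivAt g ((e.symm : E ≃L[ℝ] E) : E →L[ℝ] E) (f x) :=
      hge.congr_of_eventuallyEq hev.symm
    rw [hgd.hasFDerivAt.fderiv]
    exact ⟨e.symm, rfl⟩
  · -- injective on `f '' K`
    rintro _ ⟨x, hx, rfl⟩ _ ⟨y, hy, rfl⟩ hxy
    have hx' : g (f x) = x := by rw [hgg₀ _ (hKO (mem_image_of_mem f hx)), hleft x (hKV hx)]
    have hy' : g (f y) = y := by rw [hgg₀ _ (hKO (mem_image_of_mem f hy)), hleft y (hKV hy)]
    rw [← hx', ← hy', hxy]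


/-! ### Gluing two smooth maps which agree near the intersection of two compact sets -/

/-- **Smooth gluing.**  If `f₁`, `f₂` are smooth and agree on a neighbourhood of `K₁ ∩ K₂`
(`K₁`, `K₂` compact), there is a smooth `f` equal to `f₁` near `K₁` and to `f₂` near `K₂`:
`f = f₁ + ψ • (f₂ - f₁)` for a smooth `ψ` vanishing near `K₁ ∖ N` and equal to `1` near
`K₂ ∖ N`, `N` the open set of agreement. [folklore] -/
theorem exists_glue [FiniteDimensional ℝ E] {K₁ K₂ : Set E} (hK₁ : IsCompact K₁)
    (hK₂ : IsCompact K₂) {f₁ f₂ : E → E} (h₁ : ContDiff ℝ ∞ f₁) (h₂ : ContDiff ℝ ∞ f₂)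
    (hagree : ∀ᶠ x in 𝓝ˢ (K₁ ∩ K₂), f₁ x = f₂ x) :
    ∃ f : E → E, ContDiff ℝ ∞ f ∧ (∀ᶠ x in 𝓝ˢ K₁, f x = f₁ x) ∧ (∀ᶠ x in 𝓝ˢ K₂, f x = f₂ x) := by
  haveI : ProperSpace E := FiniteDimensional.proper ℝ E
  obtain ⟨N, hNo, hKN, hN⟩ := mem_nhdsSet_iff_exists.1 hagree
  -- the compact sets `Kᵢ ∖ N` are disjoint; separate them by open sets with disjoint closures
  have hc₁ : IsCompact (K₁ \ N) := hK₁.diff hNo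
  have hc₂ : IsCompact (K₂ \ N) := hK₂.diff hNo
  have hdisj : Disjoint (K₁ \ N) (K₂ \ N) := by
    rw [Set.disjoint_left]
    rintro x ⟨hx₁, hxN⟩ ⟨hx₂, -⟩
    exact hxN (hKN ⟨hx₁, hx₂⟩)
  obtain ⟨U₁, U₂, hU₁o, hU₂o, hKU₁, hKU₂, hUU⟩ := SeparatedNhds.of_isCompact_isCompact hc₁ hc₂ hdisj
  obtain ⟨V₁, hV₁o, hKV₁, hV₁U, -⟩ := exists_open_between_and_isCompact_closure hc₁ hU₁o hKU₁
  obtain ⟨V₂, hV₂o, hKV₂, hV₂U, -⟩ := exists_open_between_and_isCompact_closure hc₂ hU₂o hKU₂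
  have hd : Disjoint (closure V₁) (closure V₂) :=
    Set.disjoint_of_subset hV₁U hV₂U hUU
  obtain ⟨ψ, hψ0, hψ1, -⟩ := exists_contMDiffMap_zero_one_of_isClosed (I := 𝓘(ℝ, E)) (M := E)
    (n := (⊤ : ℕ∞)) isClosed_closure isClosed_closure hd
  have hψs : ContDiff ℝ ∞ (ψ : E → ℝ) := ψ.contMDiff.contDiff
  refine ⟨fun x => f₁ x + ψ x • (f₂ x - f₁ x), h₁.add (hψs.smul (h₂.sub h₁)), ?_, ?_⟩
  · refine mem_nhdsSet_iff_exists.2 ⟨N ∪ V₁, hNo.union hV₁o, fun x hx => ?_, fun x hx => ?_⟩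
    · by_cases hxN : x ∈ N
      · exact Or.inl hxN
      · exact Or.inr (hKV₁ ⟨hx, hxN⟩)
    · show f₁ x + ψ x • (f₂ x - f₁ x) = f₁ x
      rcases hx with hxN | hxV
      · rw [hN hxN, sub_self, smul_zero, add_zero]
      · rw [hψ0 (subset_closure hxV), Pi.zero_apply, zero_smul, add_zero]
  · refine mem_nhdsSet_iff_exists.2 ⟨N ∪ V₂, hNo.union hV₂o, fun x hx => ?_, fun x hx => ?_⟩
    · by_cases hxN : x ∈ N
      · exact Or.inl hxN
      · exact Or.inr (hKV₂ ⟨hx, hxN⟩)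
    · show f₁ x + ψ x • (f₂ x - f₁ x) = f₂ x
      rcases hx with hxN | hxV
      · rw [hN hxN, sub_self, smul_zero, add_zero]
      · have h1 : (ψ x : ℝ) = 1 := by
          have := hψ1 (subset_closure hxV); simpa using this
        rw [h1, one_smul, add_sub_cancel]

omit [NormedAddCommGroup E] [NormedSpace ℝ E] in
/-- Injectivity of a glued map on the union, from injectivity of the pieces and disjointness of
the images off the common part. [folklore] -/
theorem injOn_union_of_glue {K₁ K₂ : Set E} {f f₁ f₂ : E → E} (hf₁ : ∀ x ∈ K₁, f x = f₁ x)
    (hf₂ : ∀ x ∈ K₂, f x = f₂ x) (h₁ : InjOn f₁ K₁) (h₂ : InjOn f₂ K₂)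
    (hcross : ∀ x ∈ K₁, ∀ y ∈ K₂, f₁ x = f₂ y → x = y) : InjOn f (K₁ ∪ K₂) := by
  rintro x (hx | hx) y (hy | hy) hxy
  · exact h₁ hx hy (by rwa [hf₁ x hx, hf₁ y hy] at hxy)
  · exact hcross x hx y hy (by rwa [hf₁ x hx, hf₂ y hy] at hxy)
  · exact (hcross y hy x hx (by rw [hf₂ x hx, hf₁ y hy] at hxy; exact hxy.symm)).symm
  · exact h₂ hx hy (by rwa [hf₂ x hx, hf₂ y hy] at hxy)

/-! ### Families: the track of a family of embedding germs -/

section Track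

variable {F : ℝ → E → E}

/-- The derivative of the track `(t, x) ↦ (t, F t x)`. [folklore] -/
theorem hasFDerivAt_track (hF : ContDiff ℝ ∞ (uncurry F)) (q : ℝ × E) :
    HasFDerivAt (fun q : ℝ × E => ((q.1, F q.1 q.2) : ℝ × E))
      ((ContinuousLinearMap.fst ℝ ℝ E).prod (fderiv ℝ (uncurry F) q)) q :=
  hasFDerivAt_fst.prodMk ((hF.differentiable (by simp)) q).hasFDerivAt

/-- Decomposition of a linear map on `ℝ × E` along the two factors. [folklore] -/
theorem clm_apply_pair {G : Type*} [NormedAddCommGroup G] [NormedSpace ℝ G]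
    (D : ℝ × E →L[ℝ] G) (τ : ℝ) (v : E) :
    D (τ, v) = τ • D (1, 0) + D (0, v) := by
  have h : ((τ, v) : ℝ × E) = τ • ((1 : ℝ), (0 : E)) + ((0 : ℝ), v) := by
    ext <;> simp
  rw [h, map_add, map_smul]

/-- The slice derivative of a family is the restriction of the joint derivative. [folklore] -/
theorem fderiv_member_apply [CompleteSpace E] (hF : ContDiff ℝ ∞ (uncurry F)) (t : ℝ) (x v : E) :
    fderiv ℝ (F t) x v = fderiv ℝ (uncurry F) (t, x) (0, v) := by
  have h1 : HasFDerivAt (fun x : E => ((t, x) : ℝ × E)) (ContinuousLinearMap.inr ℝ ℝ E) x :=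
    (hasFDerivAt_const t x).prodMk (hasFDerivAt_id x)
  have h2 : HasFDerivAt (uncurry F) (fderiv ℝ (uncurry F) (t, x)) ((fun x : E => ((t, x) : ℝ × E)) x) :=
    ((hF.differentiable (by simp)) (t, x)).hasFDerivAt
  have h := h2.comp x h1
  have hfun : (uncurry F ∘ fun x : E => ((t, x) : ℝ × E)) = F t := rfl
  rw [hfun] at h
  rw [h.fderiv]
  rfl

/-- **The track derivative is invertible when the slice derivative is**: the derivative
`(τ, v) ↦ (τ, τ b + A v)` of the track has inverse `(τ, w) ↦ (τ, A⁻¹ (w - τ b))`.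
[folklore] -/
theorem isInvertible_fderiv_track [CompleteSpace E] (hF : ContDiff ℝ ∞ (uncurry F)) {t : ℝ}
    {x : E} (hinv : (fderiv ℝ (F t) x).IsInvertible) :
    (fderiv ℝ (fun q : ℝ × E => ((q.1, F q.1 q.2) : ℝ × E)) (t, x)).IsInvertible := by
  obtain ⟨e, he⟩ := hinv
  rw [(hasFDerivAt_track hF (t, x)).fderiv]
  obtain ⟨D, hD⟩ : ∃ D : ℝ × E →L[ℝ] E, D = fderiv ℝ (uncurry F) (t, x) := ⟨_, rfl⟩
  rw [← hD]
  have hA : ∀ v : E, D (0, v) = e v := fun v => by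
    rw [hD, ← fderiv_member_apply hF t x v, ← he]; rfl
  obtain ⟨b, hb⟩ : ∃ b : E, b = D (1, 0) := ⟨_, rfl⟩
  -- the candidate inverse
  obtain ⟨L', hL'⟩ : ∃ L' : ℝ × E →L[ℝ] ℝ × E, L' = (ContinuousLinearMap.fst ℝ ℝ E).prod
      (((e.symm : E ≃L[ℝ] E) : E →L[ℝ] E).comp (ContinuousLinearMap.snd ℝ ℝ E) -
        (ContinuousLinearMap.fst ℝ ℝ E).smulRight (e.symm b)) := ⟨_, rfl⟩
  have hL'a : ∀ τ w, L' (τ, w) = (τ, e.symm w - τ • e.symm b) := fun τ w => by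
    rw [hL']; simp [ContinuousLinearMap.smulRight_apply]
  have hLa : ∀ τ v, ((ContinuousLinearMap.fst ℝ ℝ E).prod D) (τ, v) = (τ, τ • b + e v) := fun τ v => by
    simp only [ContinuousLinearMap.prod_apply, ContinuousLinearMap.coe_fst']
    rw [clm_apply_pair D τ v, hA, hb]
  refine ⟨ContinuousLinearEquiv.equivOfInverse ((ContinuousLinearMap.fst ℝ ℝ E).prod D) L'
    (fun q => ?_) (fun q => ?_), rfl⟩
  · obtain ⟨τ, v⟩ := q
    rw [hLa, hL'a]
    ext
    · rfl
    · simp only [map_add, map_smul, ContinuousLinearEquiv.symm_apply_apply]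
      abel
  · obtain ⟨τ, w⟩ := q
    rw [hL'a, hLa]
    ext
    · rfl
    · simp only [map_sub, map_smul, ContinuousLinearEquiv.apply_symm_apply]
      abel

/-- **The track of a family of embedding germs is an embedding germ** (on `ℝ × E`, along
`T × K`). [folklore] -/
theorem track [CompleteSpace E] {T : Set ℝ} {K : Set E} (hF : ContDiff ℝ ∞ (uncurry F))
    (hinv : ∀ t ∈ T, ∀ x ∈ K, (fderiv ℝ (F t) x).IsInvertible) (hinj : ∀ t ∈ T, InjOn (F t) K) :
    IsEmbGerm (T ×ˢ K) (fun q : ℝ × E => ((q.1, F q.1 q.2) : ℝ × E)) := by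
  refine ⟨contDiff_fst.prodMk hF, fun q hq => ?_, ?_⟩
  · obtain ⟨t, x⟩ := q
    exact isInvertible_fderiv_track hF (hinv t hq.1 x hq.2)
  · rintro ⟨t, x⟩ ⟨ht, hx⟩ ⟨t', x'⟩ ⟨-, hx'⟩ h
    obtain ⟨rfl, h2⟩ := Prod.ext_iff.1 h
    exact Prod.ext rfl (hinj t ht hx hx' h2)

/-- **Inverse family.**  A jointly smooth family `F t` of embedding germs along a compact `K`,
`t` in a compact `T`, has a jointly smooth family of inverse germs `G t`:
`G t (F t x) = x` for `(t, x)` near `T × K`, `F t (G t y) = y` for `(t, y)` near the image of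
`T × K` under the track, and each `G t`, `t ∈ T`, is an embedding germ along `F t '' K`.
[folklore] -/
theorem exists_inverse_family [FiniteDimensional ℝ E] {T : Set ℝ} (hT : IsCompact T)
    {K : Set E} (hK : IsCompact K) (hF : ContDiff ℝ ∞ (uncurry F))
    (hinv : ∀ t ∈ T, ∀ x ∈ K, (fderiv ℝ (F t) x).IsInvertible) (hinj : ∀ t ∈ T, InjOn (F t) K) :
    ∃ G : ℝ → E → E, ContDiff ℝ ∞ (uncurry G) ∧
      (∀ᶠ q : ℝ × E in 𝓝ˢ (T ×ˢ K), G q.1 (F q.1 q.2) = q.2) ∧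
      (∀ᶠ q : ℝ × E in 𝓝ˢ ((fun q : ℝ × E => ((q.1, F q.1 q.2) : ℝ × E)) '' (T ×ˢ K)),
        F q.1 (G q.1 q.2) = q.2) ∧
      (∀ t ∈ T, IsEmbGerm (F t '' K) (G t)) := by
  haveI : CompleteSpace E := FiniteDimensional.complete ℝ E
  have htr := track hF hinv hinj
  obtain ⟨Gt, hGs, hleft, hright, hGg⟩ := htr.exists_inverse (hT.prod hK)
  -- the first component of the inverse track is the time
  have hfst : ∀ᶠ q : ℝ × E in 𝓝ˢ ((fun q : ℝ × E => ((q.1, F q.1 q.2) : ℝ × E)) '' (T ×ˢ K)),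
      (Gt q).1 = q.1 := hright.mono fun q hq => by
    have := congrArg Prod.fst hq
    exact this
  refine ⟨fun t y => (Gt (t, y)).2, ?_, ?_, ?_, fun t ht => ⟨?_, ?_, ?_⟩⟩
  · exact contDiff_snd.comp hGs
  · exact hleft.mono fun q hq => by
      have := congrArg Prod.snd hq
      exact this
  · filter_upwards [hright, hfst] with q hq hq1
    have h2 := congrArg Prod.snd hq
    simp only at h2
    rw [hq1] at h2
    exact h2
  · exact (contDiff_snd.comp hGs).comp (contDiff_const.prodMk contDiff_id)
  · rintro _ ⟨x, hx, rfl⟩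
    -- `G t ∘ F t = id` near `x`, so the derivative of `G t` at `F t x` inverts that of `F t`
    have hev : ∀ᶠ x' in 𝓝 x, (Gt (t, F t x')).2 = x' := by
      have hq : ((t, x) : ℝ × E) ∈ T ×ˢ K := ⟨ht, hx⟩
      have h1 : ∀ᶠ q : ℝ × E in 𝓝 (t, x), Gt (q.1, F q.1 q.2) = q :=
        hleft.filter_mono (nhds_le_nhdsSet hq)
      have hc : Continuous fun x' : E => ((t, x') : ℝ × E) := continuous_const.prodMk continuous_id
      exact (hc.tendsto x).eventually h1 |>.mono fun x' hx' => by
        have := congrArg Prod.snd hx'; exact this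
    obtain ⟨e, he⟩ := hinv t ht x hx
    have hFd : HasFDerivAt (F t) (e : E →L[ℝ] E) x := by
      rw [he]; exact ((hF.comp (contDiff_const.prodMk contDiff_id) :
        ContDiff ℝ ∞ (F t)).differentiable (by simp) x).hasFDerivAt
    have hGd : DifferentiableAt ℝ (fun y => (Gt (t, y)).2) (F t x) :=
      (((contDiff_snd.comp hGs).comp (contDiff_const.prodMk contDiff_id) :
        ContDiff ℝ ∞ fun y => (Gt (t, y)).2).differentiable (by simp)) _
    have hcomp : (fderiv ℝ (fun y => (Gt (t, y)).2) (F t x)).comp (e : E →L[ℝ] E) =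
        ContinuousLinearMap.id ℝ E := by
      rw [← hFd.fderiv, ← fderiv_comp x hGd hFd.differentiableAt]
      have hid : fderiv ℝ ((fun y => (Gt (t, y)).2) ∘ F t) x = fderiv ℝ id x :=
        Filter.EventuallyEq.fderiv_eq (hev.mono fun x' hx' => hx')
      rw [hid, fderiv_id]
    refine ⟨e.symm, ?_⟩
    have h : (fderiv ℝ (fun y => (Gt (t, y)).2) (F t x)) =
        ((fderiv ℝ (fun y => (Gt (t, y)).2) (F t x)).comp (e : E →L[ℝ] E)).comp
          ((e.symm : E ≃L[ℝ] E) : E →L[ℝ] E) := by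
      ext v; simp
    rw [h, hcomp]
    ext v; simp
  · rintro _ ⟨x, hx, rfl⟩ _ ⟨y, hy, rfl⟩ hxy
    have hq : ∀ z ∈ K, (Gt (t, F t z)).2 = z := fun z hz => by
      have h1 : ∀ᶠ q : ℝ × E in 𝓝 ((t, z) : ℝ × E), Gt (q.1, F q.1 q.2) = q :=
        hleft.filter_mono (nhds_le_nhdsSet (show ((t, z) : ℝ × E) ∈ T ×ˢ K from ⟨ht, hz⟩))
      exact congrArg Prod.snd h1.self_of_nhds
    have h1 := hq x hx
    have h2 := hq y hy
    simp only at hxy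
    rw [← h1, ← h2, hxy]

end Track

end IsEmbGerm

end Literature.Topology.FourManifolds
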